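import Summits.Schanuel.Schanuel.Theorems.ZilberEacTranscendenceDensity
import HarnessLib

/-!
# The equimodular class, LIX: THEOREM T along a RAMIFIED parametrisation — Zariski density from an
# exact transcendental relation `x = U(μ)μ^{-k}`, `y = w(μ)`

HONEST FRAMING.  Cell `pub-schanuel` (Zilber's Exponential-Algebraic Closedness, case ladder;
host summit Schanuel), seat 2, gen 26.  Gen 22's THEOREM T (file IV,
`unprojectedDense_of_transcendental_relation`) takes points with `y_{j₁} = w(1/x_{j₀})`.  On a
ramified cycle at infinity the natural parameter is `μ` with `x = U(μ)·μ^{-k}` (`U` analytic,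
`k ≥ 0`), and `y = w(μ)` is analytic in `μ`, not in `1/x`.  This file proves the same theorem in that
form: **`unprojectedDense_of_transcendental_relation_pole`** — `S` irreducible closed of dimension
`≤ 2`, `p_m ∈ S ∩ Γ_exp` with `x_{j₀}(p_m) = U(μ_m)μ_m^{-k}`, `‖x_{j₀}(p_m)‖ → ∞`,
`y_{j₁}(p_m) = w(μ_m)`, `μ_m → 0`, `μ_m ≠ 0`, and NO nonzero `H ∈ ℂ[s][t]` with
`H(U(μ)μ^{-k}, w(μ)) = 0` for all small `μ ≠ 0` ⟹ `UnprojectedDense S`.  Proof as in file IV: a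
relation on an infinite subsequence (THEOREM H machinery) and the identity principle for the analytic
function `μ ↦ μ^{kN} H(U(μ)μ^{-k}, w(μ))` (`eventually_evalPP_pole_eq_zero`).  [folklore]; nothing
here is specific to Schanuel's conjecture (neither used nor implied); Mantova–Masser's question
(PLMS 2024 §1 p. 5) stays OPEN.
-/

noncomputable section

open Filter Topology Polynomial MvPolynomial Bornology
open Literature.NumberTheory.Transcendental Literature.ModelTheory.Zilber
open Literature.ModelTheory.ExponentialFields

set_option linter.dupNamespace false

namespace Summit.Schanuel.Schanuel.Theorems

variable {n : ℕ}

/-! ## Part A. The identity principle at `μ = 0` for `μ ↦ H(U(μ)μ^{-k}, w(μ))` -/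

/-- `μ^{kN} · r(a·(μ⁻¹)^k)` as a polynomial expression in `μ` (for `deg r ≤ N`). [folklore] -/
theorem pow_mul_eval_mul_inv_pow_eq_sum (r : ℂ[X]) {N : ℕ} (hN : r.natDegree ≤ N) (k : ℕ) (a : ℂ)
    {u : ℂ} (hu : u ≠ 0) :
    u ^ (k * N) * r.eval (a * u⁻¹ ^ k) =
      ∑ i ∈ Finset.range (N + 1), r.coeff i * a ^ i * u ^ (k * (N - i)) := by
  rw [Polynomial.eval_eq_sum_range' (Nat.lt_succ_of_le hN), Finset.mul_sum]
  refine Finset.sum_congr rfl fun i hi => ?_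
  have hi' : i ≤ N := Nat.lt_succ_iff.1 (Finset.mem_range.1 hi)
  rw [mul_pow, ← pow_mul, inv_pow, Nat.mul_sub, pow_sub₀ _ hu (Nat.mul_le_mul_left k hi')]
  ring

/-- **Identity principle (ramified form).**  If `U, w` are analytic at `0`, `H ∈ ℂ[s][t]`, and
`H(U(μ_j)μ_j^{-k}, w(μ_j)) = 0` along a sequence `μ_j → 0`, `μ_j ≠ 0`, then
`H(U(μ)μ^{-k}, w(μ)) = 0` for all small `μ ≠ 0`. [folklore] -/
theorem eventually_evalPP_pole_eq_zero {U w : ℂ → ℂ} (hU : AnalyticAt ℂ U 0) (hw : AnalyticAt ℂ w 0)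
    (k : ℕ) (H : ℂ[X][X]) {μ : ℕ → ℂ} (hμ0 : ∀ j, μ j ≠ 0) (hμ : Tendsto μ atTop (𝓝 0))
    (hH : ∀ j, (H.map (Polynomial.evalRingHom (U (μ j) * (μ j)⁻¹ ^ k))).eval (w (μ j)) = 0) :
    ∀ᶠ u in 𝓝[≠] (0 : ℂ), (H.map (Polynomial.evalRingHom (U u * u⁻¹ ^ k))).eval (w u) = 0 := by
  classical
  -- a common bound for the `s`-degrees of the coefficients
  set N : ℕ := (Finset.range (H.natDegree + 1)).sup fun j => (H.coeff j).natDegree with hN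
  have hNj : ∀ j ∈ Finset.range (H.natDegree + 1), (H.coeff j).natDegree ≤ N := fun j hj =>
    Finset.le_sup (f := fun j => (H.coeff j).natDegree) hj
  -- the analytic function `h(u) = u^{kN} H(U(u) u^{-k}, w u)`
  set h : ℂ → ℂ := fun u => ∑ j ∈ Finset.range (H.natDegree + 1),
    (∑ i ∈ Finset.range (N + 1), (H.coeff j).coeff i * U u ^ i * u ^ (k * (N - i))) * w u ^ j with hh
  have hhan : AnalyticAt ℂ h 0 := by
    refine Finset.analyticAt_fun_sum _ fun j _ => AnalyticAt.mul ?_ (hw.pow j)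
    exact Finset.analyticAt_fun_sum _ fun i _ =>
      (analyticAt_const.mul (hU.pow i)).mul (analyticAt_id.pow _)
  have hh_eq : ∀ u : ℂ, u ≠ 0 →
      h u = u ^ (k * N) * (H.map (Polynomial.evalRingHom (U u * u⁻¹ ^ k))).eval (w u) := by
    intro u hu
    rw [hh, evalPP_eq_sum H _ (w u) (Nat.lt_succ_self _), Finset.mul_sum]
    refine Finset.sum_congr rfl fun j hj => ?_
    rw [← pow_mul_eval_mul_inv_pow_eq_sum _ (hNj j hj) k (U u) hu]
    ring
  -- zeros of `h` accumulating at `0`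
  have hμ' : Tendsto μ atTop (𝓝[≠] (0 : ℂ)) :=
    tendsto_nhdsWithin_iff.2 ⟨hμ, Eventually.of_forall fun j => hμ0 j⟩
  have hzero : ∀ j, h (μ j) = 0 := fun j => by
    rw [hh_eq _ (hμ0 j), hH j, mul_zero]
  rcases hhan.eventually_eq_zero_or_eventually_ne_zero with h0 | hne
  · have h0' : ∀ᶠ u in 𝓝[≠] (0 : ℂ), h u = 0 ∧ u ≠ 0 :=
      (h0.filter_mono nhdsWithin_le_nhds).and self_mem_nhdsWithin
    filter_upwards [h0'] with u hu'
    have h1 := hu'.1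
    rw [hh_eq u hu'.2] at h1
    exact (mul_eq_zero.1 h1).resolve_left (pow_ne_zero _ hu'.2)
  · exfalso
    obtain ⟨j, hj⟩ := (hμ'.eventually hne).exists
    exact hj (hzero j)

/-! ## Part B. THEOREM T, ramified form -/

/-- **THEOREM T along a ramified parametrisation (finiteness).**  On an irreducible closed `S` of
dimension `≤ 2`, let `p_m ∈ S` with `x_{j₀}(p_m) = U(μ_m)μ_m^{-k}`, `‖x_{j₀}(p_m)‖ → ∞`,
`y_{j₁}(p_m) = w(μ_m)`, `μ_m → 0`, `μ_m ≠ 0`, where `U, w` are analytic at `0` and no nonzero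
`H ∈ ℂ[s][t]` has `H(U(μ)μ^{-k}, w(μ)) = 0` for all small `μ ≠ 0`.  Then every `f ∉ I(S)` vanishes at
only finitely many `p_m`. [folklore] (new in this form) -/
theorem finite_zeros_of_transcendental_relation_pole {S : Set (Fin n ⊕ Fin n → ℂ)}
    (hS : IsIrreducibleClosed ℂ S) (hdim : zariskiDim ℂ S ≤ (2 : ℕ)) (j₀ j₁ : Fin n)
    {p : ℕ → Fin n ⊕ Fin n → ℂ} (hpS : ∀ m, p m ∈ S)
    (hnorm : Tendsto (fun m => ‖p m (Sum.inl j₀)‖) atTop atTop)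
    {U w : ℂ → ℂ} (hU : AnalyticAt ℂ U 0) (hw : AnalyticAt ℂ w 0) (k : ℕ) {μ : ℕ → ℂ}
    (hμ0 : ∀ m, μ m ≠ 0) (hμ : Tendsto μ atTop (𝓝 0))
    (hx : ∀ m, p m (Sum.inl j₀) = U (μ m) * (μ m)⁻¹ ^ k) (hy : ∀ m, p m (Sum.inr j₁) = w (μ m))
    (htr : ∀ H : ℂ[X][X], H ≠ 0 →
      ¬ (∀ᶠ u in 𝓝[≠] (0 : ℂ), (H.map (Polynomial.evalRingHom (U u * u⁻¹ ^ k))).eval (w u) = 0))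
    (f : MvPolynomial (Fin n ⊕ Fin n) ℂ) (hf : f ∉ vanishingIdeal ℂ S) :
    Set.Finite {m | aeval (p m) f = 0} := by
  classical
  by_contra hinf
  change Set.Infinite {m | aeval (p m) f = 0} at hinf
  set x : ℕ → ℂ := fun m => p m (Sum.inl j₀) with hxdef
  -- a prime vanishing ideal of an infinite subsequence of zeros of `f`
  obtain ⟨M, hMinf, hMf, hJ⟩ := exists_infinite_isPrime_vanishingIdeal hinf
  set J := vanishingIdeal ℂ (p '' M) with hJdef
  haveI := hJ
  have hIJ : vanishingIdeal ℂ S ≤ J :=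
    vanishingIdeal_anti_mono (by rintro _ ⟨m, -, rfl⟩; exact hpS m)
  have hfJ : f ∈ J := by
    rw [hJdef, mem_vanishingIdeal_iff]
    rintro _ ⟨m, hm, rfl⟩
    exact hMf m hm
  have hdimJ := ringKrullDim_quotient_le_one hS hdim hIJ hfJ hf
  set Q' := MvPolynomial (Fin n ⊕ Fin n) ℂ ⧸ J with hQ'
  haveI : IsDomain Q' := Ideal.Quotient.isDomain _
  have htr1 : Algebra.trdeg ℂ Q' ≤ 1 := by
    have h := Literature.RingTheory.KrullDimension.ringKrullDim_eq_trdeg ℂ Q'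
    rw [h] at hdimJ
    have hnat : Cardinal.toNat (Algebra.trdeg ℂ Q') ≤ 1 := by exact_mod_cast hdimJ
    rw [Literature.RingTheory.KrullDimension.trdeg_eq_toNat ℂ Q']
    exact_mod_cast hnat
  -- `x_{j₀}` transcendental, `y_{j₁}` algebraic over `ℂ[x_{j₀}]` modulo `J`
  have hxM : ∀ R : ℝ, ∃ m ∈ M, R ≤ ‖x m‖ := by
    intro R
    rcases (tendsto_atTop_atTop.1 hnorm R) with ⟨N', hN'⟩
    obtain ⟨m, hm, hNm⟩ := hMinf.exists_gt N'
    exact ⟨m, hm, hN' m hNm.le⟩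
  haveI : FaithfulSMul ℂ Q' := (faithfulSMul_iff_algebraMap_injective ℂ Q').2 (algebraMap ℂ Q').injective
  have hutr := transcendental_mk_X_of_unbounded (p := p) (M := M) j₀ hxM
  obtain ⟨H, hH0, hHuv⟩ := exists_polyPoly_relation
    (isAlgebraic_adjoin_of_trdeg_le_one htr1 hutr (Ideal.Quotient.mk J (X (Sum.inr j₁))))
  have hHroot : ∀ m ∈ M,
      (H.map (Polynomial.evalRingHom (U (μ m) * (μ m)⁻¹ ^ k))).eval (w (μ m)) = 0 := by
    intro m hm
    rw [← hx m, ← hy m]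
    exact polyPoly_eval_eq_zero_of_mem₂ (Sum.inl j₀) (Sum.inr j₁) hHuv hm
  -- pass to the subsequence indexed by `M` and apply the identity principle
  set φ : ℕ → ℕ := Nat.nth (· ∈ M) with hφ
  have hφM : ∀ i, φ i ∈ M := fun i => Nat.nth_mem_of_infinite (p := (· ∈ M)) hMinf i
  have hφtop : Tendsto φ atTop atTop := (Nat.nth_strictMono (p := (· ∈ M)) hMinf).tendsto_atTop
  exact htr H hH0 (eventually_evalPP_pole_eq_zero hU hw k H (fun i => hμ0 (φ i)) (hμ.comp hφtop)
    fun i => hHroot _ (hφM i))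

/-- **THEOREM T along a ramified parametrisation (density).**  If the sequence of
`finite_zeros_of_transcendental_relation_pole` consists of exponential points of `S`, then `S` has
Zariski-dense exponential points (`UnprojectedDense S`). [folklore] (new in this form) -/
theorem unprojectedDense_of_transcendental_relation_pole {S : Set (Fin n ⊕ Fin n → ℂ)}
    (hS : IsIrreducibleClosed ℂ S) (hdim : zariskiDim ℂ S ≤ (2 : ℕ)) (j₀ j₁ : Fin n)
    {p : ℕ → Fin n ⊕ Fin n → ℂ} (hpS : ∀ m, p m ∈ S) (hpΓ : ∀ m, p m ∈ expGraph ℂ n)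
    (hnorm : Tendsto (fun m => ‖p m (Sum.inl j₀)‖) atTop atTop)
    {U w : ℂ → ℂ} (hU : AnalyticAt ℂ U 0) (hw : AnalyticAt ℂ w 0) (k : ℕ) {μ : ℕ → ℂ}
    (hμ0 : ∀ m, μ m ≠ 0) (hμ : Tendsto μ atTop (𝓝 0))
    (hx : ∀ m, p m (Sum.inl j₀) = U (μ m) * (μ m)⁻¹ ^ k) (hy : ∀ m, p m (Sum.inr j₁) = w (μ m))
    (htr : ∀ H : ℂ[X][X], H ≠ 0 →
      ¬ (∀ᶠ u in 𝓝[≠] (0 : ℂ), (H.map (Polynomial.evalRingHom (U u * u⁻¹ ^ k))).eval (w u) = 0)) :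
    UnprojectedDense S := by
  refine le_antisymm ?_ (vanishingIdeal_anti_mono Set.inter_subset_left)
  intro f hf
  by_contra hfS
  have hfin := finite_zeros_of_transcendental_relation_pole hS hdim j₀ j₁ hpS hnorm hU hw k hμ0 hμ hx
    hy htr f hfS
  have hall : {m | aeval (p m) f = 0} = Set.univ := by
    ext m
    simp only [Set.mem_setOf_eq, Set.mem_univ, iff_true]
    exact (mem_vanishingIdeal_iff.1 hf) _ ⟨hpS m, hpΓ m⟩
  rw [hall] at hfin
  exact Set.infinite_univ hfin

/-- Transcendence along a ramified parametrisation is preserved by a nonzero constant factor.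
[folklore] -/
theorem transcendental_pole_const_mul {U w : ℂ → ℂ} {k : ℕ} {ζ : ℂ} (hζ : ζ ≠ 0)
    (htr : ∀ H : ℂ[X][X], H ≠ 0 →
      ¬ (∀ᶠ u in 𝓝[≠] (0 : ℂ), (H.map (Polynomial.evalRingHom (U u * u⁻¹ ^ k))).eval (w u) = 0))
    (H : ℂ[X][X]) (hH0 : H ≠ 0) :
    ¬ (∀ᶠ u in 𝓝[≠] (0 : ℂ),
      (H.map (Polynomial.evalRingHom (U u * u⁻¹ ^ k))).eval (ζ * w u) = 0) := by
  intro h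
  set Hζ : ℂ[X][X] := H.comp (Polynomial.C (Polynomial.C ζ) * Polynomial.X) with hHζ
  refine htr Hζ ?_ ?_
  · rw [hHζ, Ne, Polynomial.comp_eq_zero_iff, not_or]
    refine ⟨hH0, fun h2 => ?_⟩
    have h3 := congrArg (fun q : ℂ[X][X] => q.coeff 1) h2.2
    simp only [Polynomial.coeff_C_mul, Polynomial.coeff_X_one, mul_one, Polynomial.coeff_C_succ,
      Polynomial.mul_coeff_zero, Polynomial.coeff_X_zero, mul_zero] at h3
    exact hζ (by simpa using h3)
  · filter_upwards [h] with u hu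
    rw [hHζ, Polynomial.map_comp, Polynomial.eval_comp]
    simpa using hu

end Summit.Schanuel.Schanuel.Theorems
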